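import Mathlib
import HarnessLib
import Summits.Ventures.LatticeQCDFlow.Scoring.BatchMeansFixedBatchCount
import Summits.Ventures.LatticeQCDFlow.Scoring.IndependentFamilyJointLimit

/-!
# BETWEEN-REPLICA ERROR BARS AT A FIXED NUMBER OF STREAMS: `R` independent runs of one sampler from
# ANY starts — the replica standard error is NOT consistent (`χ²_{R−1}`-type law) and
# `x̄̄ ± z · SE_rep` has STUDENT-`t_{R−1}`, not normal, asymptotic coverage

HONEST FRAMING: exact (Metropolis-corrected) sampling algorithms for lattice gauge theory;
figures of merit are autocorrelation/cost numbers at stated couplings and volumes; no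
continuum-physics claim.

Venture `LatticeQCDFlow` (cell pub-lqcd), topic `Scoring`; FANOUT row 4 (`s0-u1-b`, GEN-32).
NEW WORK of the cell, not a published result; no definition is introduced; nothing is cited as a
fact.  The cell's cards quote `mean ± max(Γ error, between-replica SE)` over `R` independent streams
(`R = 8` or `16`); `Scoring/ReplicaError.lean` (row 11) gives the expectation of the between-replica
`SE²` exactly and names its `χ²`-type scatter NOT typed.  This file types it, together with the
calibration of the interval: for every kernel with a geometric sup-norm envelope (every kernel one of
whose powers is Doeblin), every bounded observable, `R` INDEPENDENT runs of length `n → ∞` from ANY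
initial laws `μ_r` (product path law `⊗_r P_{μ_r}`), replica means `M_r = (1/n) Σ_{t<n} f(X^r_t)`,
grand mean `M̄` and `SE²_rep = Σ_r (M_r − M̄)²/(R(R−1))`:
(1) the vector `(√n (M_r − πf))_{r<R}` converges in distribution to `√σ²_f • g`, `g ∼ N(0, I_R)`
(the any-start CLT of `Scoring/WeightedBlockSumCLT.lean` per replica + the independent-family joint
limit of `Scoring/IndependentFamilyJointLimit.lean`);
(2) `n R · SE²_rep ⇒ σ²_f · s²(g)` (`(R−1) s²(g) ∼ χ²_{R−1}`): NOT consistent at fixed `R`;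
(3) for `σ²_f > 0`, `R ≥ 2`, `z ≥ 0`: `(⊗_r P_{μ_r})(|M̄ − πf| ≤ z √SE²_rep) → N(0,1)^{⊗R}{R ḡ² ≤ z² s²(g)}`,
the two-sided Student-`t_{R−1}` probability of `[−z, z]` (named; the null boundary is
`Scoring/GaussianStudentBoundary.lean`).  READING: with `R = 8` streams the nominal one-sigma
replica bar has asymptotic coverage `P(|t_7| ≤ 1)`, not `0.683`.  Printed counterpart NAMED ONLY:
the method of independent replications and its `t_{R−1}` interval (Law–Kelton 2000 §9.4–9.5;
Alexopoulos–Goldsman 2004), nothing cited as a fact.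

## Content (`π` invariant, envelope `(A, ρ)`; `|f| ≤ C` measurable; `P_{μ_r}` path laws from ANY
## starts; the limit space is `(Fin R → ℝ, N(0,1)^{⊗R})` itself)

* `replica_sigmaHat_eq_svar`, `replica_coverage_iff_student` — the algebra of (2), (3) for any
  `B : Fin R → ℝ`;
* **`chain_replicaMeans_joint_clt_of_envelope`** — (1);
* **`chain_replicaSE_fixedCount_tendsto_of_envelope`** — (2);
* **`chain_replicaMeans_fixedCount_coverage_of_envelope`** — (3).

NOT CLAIMED: unequal replica lengths; the Γ-error half of the card's `max(Γ, SE_rep)`; the value of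
the Student probability; any number of ours.
-/

noncomputable section

namespace Summit.Ventures.LatticeQCDFlow.Scoring

open MeasureTheory ProbabilityTheory Filter Finset Preorder
open scoped ENNReal Topology RealInnerProductSpace

variable {Ω : Type*} [MeasurableSpace Ω]

/-! ### Algebra of the replica statistics (any reals `B_r`) -/

section Algebra

/-- With `V_r = √n (B_r − c)`: `n R · Σ_r (B_r − B̄)²/(R(R−1)) = Σ_r (V_r − V̄)²/(R − 1)` (`n ≥ 1`). -/
theorem replica_sigmaHat_eq_svar {R : ℕ} (B : Fin R → ℝ) (c : ℝ) {n : ℕ} (hn : 0 < n) :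
    ((n * R : ℕ) : ℝ) * ((∑ r, (B r - (∑ i, B i) / (R : ℝ)) ^ 2) / ((R : ℝ) * ((R : ℝ) - 1)))
      = (∑ r, (Real.sqrt n * (B r - c) - (∑ i, Real.sqrt n * (B i - c)) / (R : ℝ)) ^ 2) / ((R : ℝ) - 1) := by
  have hnR : (0 : ℝ) < n := Nat.cast_pos.2 hn
  rcases Nat.lt_or_ge R 2 with hR | hR
  · interval_cases R
    · simp
    · simp
  have hRR : (2 : ℝ) ≤ R := by exact_mod_cast hR
  have hR0 : (R : ℝ) ≠ 0 := by linarith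
  have hR1 : (R : ℝ) - 1 ≠ 0 := by linarith
  have hdev : ∀ r, Real.sqrt n * (B r - c) - (∑ i, Real.sqrt n * (B i - c)) / (R : ℝ)
      = Real.sqrt n * (B r - (∑ i, B i) / (R : ℝ)) := by
    intro r
    rw [← Finset.mul_sum, Finset.sum_sub_distrib, Finset.sum_const, Finset.card_univ, Fintype.card_fin,
      nsmul_eq_mul]
    field_simp
    ring
  simp_rw [hdev, mul_pow, Real.sq_sqrt hnR.le, ← Finset.mul_sum]
  rw [Nat.cast_mul]
  field_simp

/-- `R ≥ 2`, `n ≥ 1`, `z ≥ 0`: `|B̄ − c| ≤ z √(Σ_r (B_r − B̄)²/(R(R−1))) ↔ R V̄² − z² s²(V) ≤ 0`,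
`V_r = √n (B_r − c)`. -/
theorem replica_coverage_iff_student {R : ℕ} (B : Fin R → ℝ) (c : ℝ) (hR : 2 ≤ R) {n : ℕ} (hn : 0 < n)
    {z : ℝ} (hz : 0 ≤ z) :
    |(∑ r, B r) / (R : ℝ) - c| ≤ z * Real.sqrt ((∑ r, (B r - (∑ i, B i) / (R : ℝ)) ^ 2) / ((R : ℝ) * ((R : ℝ) - 1)))
      ↔ (R : ℝ) * ((∑ i, Real.sqrt n * (B i - c)) / (R : ℝ)) ^ 2
          - z ^ 2 * ((∑ r, (Real.sqrt n * (B r - c) - (∑ i, Real.sqrt n * (B i - c)) / (R : ℝ)) ^ 2)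
              / ((R : ℝ) - 1)) ≤ 0 := by
  have hnR : (0 : ℝ) < n := Nat.cast_pos.2 hn
  have hRR : (2 : ℝ) ≤ R := by exact_mod_cast hR
  have hR0 : (0 : ℝ) < R := by linarith
  have hsv := replica_sigmaHat_eq_svar B c (R := R) hn
  set SE2 := (∑ r, (B r - (∑ i, B i) / (R : ℝ)) ^ 2) / ((R : ℝ) * ((R : ℝ) - 1)) with hSE2
  have hSE2nn : 0 ≤ SE2 := div_nonneg (Finset.sum_nonneg fun r _ => sq_nonneg _) (mul_nonneg hR0.le (by linarith))
  have hVbar : (∑ i, Real.sqrt n * (B i - c)) / (R : ℝ) = Real.sqrt n * ((∑ r, B r) / (R : ℝ) - c) := by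
    rw [← Finset.mul_sum, Finset.sum_sub_distrib, Finset.sum_const, Finset.card_univ, Fintype.card_fin,
      nsmul_eq_mul]
    field_simp
  rw [← hsv, hVbar]
  have hv0 : 0 ≤ z * Real.sqrt SE2 := mul_nonneg hz (Real.sqrt_nonneg _)
  have key : |(∑ r, B r) / (R : ℝ) - c| ≤ z * Real.sqrt SE2
      ↔ ((∑ r, B r) / (R : ℝ) - c) ^ 2 ≤ (z * Real.sqrt SE2) ^ 2 := by
    constructor
    · intro h
      have := pow_le_pow_left₀ (abs_nonneg _) h 2
      rwa [sq_abs] at this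
    · intro h
      exact abs_le_of_sq_le_sq h hv0
  rw [key, mul_pow, Real.sq_sqrt hSE2nn, Nat.cast_mul]
  have hab : (0 : ℝ) < n * R := mul_pos hnR hR0
  have hsq' : (R : ℝ) * (Real.sqrt n * ((∑ r, B r) / (R : ℝ) - c)) ^ 2 = (n : ℝ) * R * ((∑ r, B r) / (R : ℝ) - c) ^ 2 := by
    rw [mul_pow, Real.sq_sqrt hnR.le]; ring
  rw [hsq']
  constructor
  · intro h
    have h2 := mul_le_mul_of_nonneg_left h hab.le
    linarith [h2]
  · intro h
    by_contra hlt
    push Not at hlt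
    have h2 := mul_lt_mul_of_pos_left hlt hab
    linarith [h2]

end Algebra

/-! ### The limit theorems -/

section Envelope

variable {κ : Kernel Ω Ω} [IsMarkovKernel κ] {π : Measure Ω} [IsProbabilityMeasure π] {A ρ : ℝ}

/-- **THE JOINT CLT OF `R` INDEPENDENT REPLICA MEANS, FROM ANY STARTS.**  `π` invariant, envelope
`(A, ρ)`, `|f| ≤ C` measurable; replicas `r < R` run independently from `μ_r`, each of length `n`.
On `⊗_r P_{μ_r}` the vector `(n^{-1/2} Σ_{t<n} f̄(X^r_t))_{r<R}` converges in distribution to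
`g ↦ √σ²_f • g` under `N(0,1)^{⊗R}` (read in `EuclideanSpace`). -/
theorem chain_replicaMeans_joint_clt_of_envelope (hπ : Kernel.Invariant κ π)
    (henv : ∀ (g : Ω → ℝ), Measurable g → ∀ (Cg : ℝ), (∀ x, |g x| ≤ Cg) →
      ∀ (t : ℕ) (x : Ω), |(kop κ)^[t] g x - ∫ y, g y ∂π| ≤ 2 * Cg * (A * ρ ^ t))
    (hA : 0 ≤ A) (hρ0 : 0 ≤ ρ) (hρ1 : ρ < 1)
    {f : Ω → ℝ} (hf : Measurable f) {C : ℝ} (hC : ∀ x, |f x| ≤ C)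
    {R : ℕ} (μs : Fin R → Measure Ω) [∀ r, IsProbabilityMeasure (μs r)]
    [∀ r, IsProbabilityMeasure (Kernel.trajMeasure (X := fun _ : ℕ => Ω) (μs r)
          (fun n : ℕ => κ.comap (fun h' : (i : ↥(Finset.Iic n)) → Ω => h' ⟨n, Finset.mem_Iic.2 le_rfl⟩)
            (measurable_pi_apply _)))] :
    TendstoInDistribution (fun (n : ℕ) (ω : Fin R → (ℕ → Ω)) =>
        (WithLp.toLp 2 (fun r : Fin R => (∑ t ∈ Finset.range n, (f (ω r t) - ∫ z, f z ∂π)) / Real.sqrt n)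
          : EuclideanSpace ℝ (Fin R)))
      atTop (fun g : Fin R → ℝ => (WithLp.toLp 2 (fun r : Fin R =>
        Real.sqrt (((∫ y, (f y - ∫ z, f z ∂(π)) ^ 2 ∂(π)) + 2 * ∑' k, ∫ y, (f y - ∫ z, f z ∂(π)) * (kop (κ))^[k + 1] (fun y => f y - ∫ z, f z ∂(π)) y ∂(π))) * g r)
          : EuclideanSpace ℝ (Fin R)))
      (fun _ => Measure.pi fun r => (Kernel.trajMeasure (X := fun _ : ℕ => Ω) (μs r)
          (fun n : ℕ => κ.comap (fun h' : (i : ↥(Finset.Iic n)) → Ω => h' ⟨n, Finset.mem_Iic.2 le_rfl⟩)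
            (measurable_pi_apply _))))
      (Measure.pi fun _ : Fin R => gaussianReal 0 1) := by
  set σ2 : ℝ := ((∫ y, (f y - ∫ z, f z ∂(π)) ^ 2 ∂(π)) + 2 * ∑' k, ∫ y, (f y - ∫ z, f z ∂(π)) * (kop (κ))^[k + 1] (fun y => f y - ∫ z, f z ∂(π)) y ∂(π)) with hσ2
  have hσ2nn : 0 ≤ σ2 := greenKubo_nonneg_of_envelope hπ henv hρ0 hρ1 hf hC
  obtain ⟨hfbm, -, -⟩ := centred_observable_bounds π hf hC
  -- the limit family: scaled coordinates of the product Gaussian, independent with law `N(0, σ²)`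
  have hcoord : ∀ r : Fin R, HasLaw (fun g : Fin R → ℝ => g r) (gaussianReal 0 1)
      (Measure.pi fun _ : Fin R => gaussianReal 0 1) := fun r =>
    ⟨(measurable_pi_apply r).aemeasurable, (measurePreserving_eval _ r).map_eq⟩
  have hZlaw : ∀ r : Fin R, HasLaw (fun g : Fin R → ℝ => Real.sqrt σ2 * g r)
      (gaussianReal 0 (Real.toNNReal ((∑ j ∈ Finset.range 1, (fun _ : ℕ => (1 : ℝ)) j ^ 2) * σ2)))
      (Measure.pi fun _ : Fin R => gaussianReal 0 1) := by
    intro r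
    have h := gaussianReal_const_mul (hcoord r) (Real.sqrt σ2)
    rw [mul_zero] at h
    convert h using 2
    apply NNReal.eq
    rw [Real.coe_toNNReal _ (by simp [hσ2nn]), NNReal.coe_mul, NNReal.coe_mk, NNReal.coe_one, mul_one,
      Real.sq_sqrt hσ2nn]
    simp
  have hZind : iIndepFun (fun (r : Fin R) (g : Fin R → ℝ) => Real.sqrt σ2 * g r)
      (Measure.pi fun _ : Fin R => gaussianReal 0 1) :=
    (iIndepFun_pi (X := fun (_ : Fin R) (x : ℝ) => x) fun _ => aemeasurable_id).comp
      (fun _ x => Real.sqrt σ2 * x) fun _ => measurable_const_mul _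
  -- the one-replica CLT from any start (the `a = 1` case of the weighted batch-sum CLT)
  have hone : ∀ r : Fin R, TendstoInDistribution (fun (n : ℕ) (x : ℕ → Ω) =>
        (∑ t ∈ Finset.range n, (f (x t) - ∫ z, f z ∂π)) / Real.sqrt n)
      atTop (fun g : Fin R → ℝ => Real.sqrt σ2 * g r)
      (fun _ => (Kernel.trajMeasure (X := fun _ : ℕ => Ω) (μs r)
          (fun n : ℕ => κ.comap (fun h' : (i : ↥(Finset.Iic n)) → Ω => h' ⟨n, Finset.mem_Iic.2 le_rfl⟩)
            (measurable_pi_apply _))))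
      (Measure.pi fun _ : Fin R => gaussianReal 0 1) := by
    intro r
    have h := chain_weightedBlockSum_clt_of_envelope hπ henv hA hρ0 hρ1 hf hC (μs r) (fun _ : ℕ => (1 : ℝ)) 1
      (b := fun n => n) tendsto_id (hZlaw r)
    refine h.congr (fun n => ae_of_all _ fun x => ?_) (ae_of_all _ fun g => rfl)
    show (∑ j ∈ Finset.range 1, (1 : ℝ) * ∑ t ∈ Finset.range n, (f (x (n * j + t)) - ∫ z, f z ∂π)) / Real.sqrt n
      = (∑ t ∈ Finset.range n, (f (x t) - ∫ z, f z ∂π)) / Real.sqrt n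
    simp
  have hXm : ∀ (r : Fin R) (n : ℕ), Measurable fun x : ℕ → Ω =>
      (∑ t ∈ Finset.range n, (f (x t) - ∫ z, f z ∂π)) / Real.sqrt n := fun r n =>
    (Finset.measurable_sum _ fun t _ => hfbm.comp (measurable_pi_apply _)).div_const _
  exact CardConsistency.tendstoInDistribution_replicas (Ps := fun r => (Kernel.trajMeasure (X := fun _ : ℕ => Ω) (μs r)
          (fun n : ℕ => κ.comap (fun h' : (i : ↥(Finset.Iic n)) → Ω => h' ⟨n, Finset.mem_Iic.2 le_rfl⟩)
            (measurable_pi_apply _)))) hone hXm (fun r => measurable_const_mul _ |>.comp (measurable_pi_apply r)) hZind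

/-- **AT A FIXED NUMBER OF REPLICAS THE BETWEEN-REPLICA ERROR BAR IS NOT CONSISTENT**: with
`M_r = (1/n) Σ_{t<n} f(X^r_t)`, `n R · Σ_r (M_r − M̄)²/(R(R−1)) ⇒ σ²_f · s²(g)`, `g ∼ N(0,1)^{⊗R}`. -/
theorem chain_replicaSE_fixedCount_tendsto_of_envelope (hπ : Kernel.Invariant κ π)
    (henv : ∀ (g : Ω → ℝ), Measurable g → ∀ (Cg : ℝ), (∀ x, |g x| ≤ Cg) →
      ∀ (t : ℕ) (x : Ω), |(kop κ)^[t] g x - ∫ y, g y ∂π| ≤ 2 * Cg * (A * ρ ^ t))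
    (hA : 0 ≤ A) (hρ0 : 0 ≤ ρ) (hρ1 : ρ < 1)
    {f : Ω → ℝ} (hf : Measurable f) {C : ℝ} (hC : ∀ x, |f x| ≤ C)
    {R : ℕ} (μs : Fin R → Measure Ω) [∀ r, IsProbabilityMeasure (μs r)]
    [∀ r, IsProbabilityMeasure (Kernel.trajMeasure (X := fun _ : ℕ => Ω) (μs r)
          (fun n : ℕ => κ.comap (fun h' : (i : ↥(Finset.Iic n)) → Ω => h' ⟨n, Finset.mem_Iic.2 le_rfl⟩)
            (measurable_pi_apply _)))] :
    TendstoInDistribution (fun (n : ℕ) (ω : Fin R → (ℕ → Ω)) =>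
        ((n * R : ℕ) : ℝ) * ((∑ r, ((∑ t ∈ Finset.range n, f (ω r t)) / n
            - (∑ i, (∑ t ∈ Finset.range n, f (ω i t)) / n) / (R : ℝ)) ^ 2) / ((R : ℝ) * ((R : ℝ) - 1))))
      atTop (fun g : Fin R → ℝ => (((∫ y, (f y - ∫ z, f z ∂(π)) ^ 2 ∂(π)) + 2 * ∑' k, ∫ y, (f y - ∫ z, f z ∂(π)) * (kop (κ))^[k + 1] (fun y => f y - ∫ z, f z ∂(π)) y ∂(π)))
        * ((∑ j, (g j - (∑ i, g i) / (R : ℝ)) ^ 2) / ((R : ℝ) - 1)))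
      (fun _ => Measure.pi fun r => (Kernel.trajMeasure (X := fun _ : ℕ => Ω) (μs r)
          (fun n : ℕ => κ.comap (fun h' : (i : ↥(Finset.Iic n)) → Ω => h' ⟨n, Finset.mem_Iic.2 le_rfl⟩)
            (measurable_pi_apply _))))
      (Measure.pi fun _ : Fin R => gaussianReal 0 1) := by
  set σ2 : ℝ := ((∫ y, (f y - ∫ z, f z ∂(π)) ^ 2 ∂(π)) + 2 * ∑' k, ∫ y, (f y - ∫ z, f z ∂(π)) * (kop (κ))^[k + 1] (fun y => f y - ∫ z, f z ∂(π)) y ∂(π)) with hσ2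
  have hσ2nn : 0 ≤ σ2 := greenKubo_nonneg_of_envelope hπ henv hρ0 hρ1 hf hC
  have hJ := chain_replicaMeans_joint_clt_of_envelope hπ henv hA hρ0 hρ1 hf hC μs
  have hcont := hJ.continuous_comp (continuous_euclidean_svar R)
  refine hcont.congr (fun n => ae_of_all _ fun ω => ?_) (ae_of_all _ fun g => ?_)
  · show (∑ j : Fin R, ((WithLp.toLp 2 (fun r : Fin R =>
          (∑ t ∈ Finset.range n, (f (ω r t) - ∫ z, f z ∂π)) / Real.sqrt n) : EuclideanSpace ℝ (Fin R)) j
          - (∑ i : Fin R, (WithLp.toLp 2 (fun r : Fin R =>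
          (∑ t ∈ Finset.range n, (f (ω r t) - ∫ z, f z ∂π)) / Real.sqrt n) : EuclideanSpace ℝ (Fin R)) i) / (R : ℝ)) ^ 2)
          / ((R : ℝ) - 1)
      = ((n * R : ℕ) : ℝ) * ((∑ r, ((∑ t ∈ Finset.range n, f (ω r t)) / n
            - (∑ i, (∑ t ∈ Finset.range n, f (ω i t)) / n) / (R : ℝ)) ^ 2) / ((R : ℝ) * ((R : ℝ) - 1)))
    dsimp only
    rcases Nat.eq_zero_or_pos n with hn0 | hn0
    · subst hn0; simp
    have hnR : (0 : ℝ) < n := Nat.cast_pos.2 hn0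
    have hsn : 0 < Real.sqrt n := Real.sqrt_pos.2 hnR
    have hV : ∀ r : Fin R, (∑ t ∈ Finset.range n, (f (ω r t) - ∫ z, f z ∂π)) / Real.sqrt n
        = Real.sqrt n * ((∑ t ∈ Finset.range n, f (ω r t)) / n - ∫ z, f z ∂π) := by
      intro r
      have hsq : Real.sqrt (n : ℝ) * Real.sqrt n = n := Real.mul_self_sqrt hnR.le
      rw [div_eq_iff hsn.ne', Finset.sum_sub_distrib, Finset.sum_const, Finset.card_range, nsmul_eq_mul]
      have : Real.sqrt (n : ℝ) * ((∑ t ∈ Finset.range n, f (ω r t)) / n - ∫ z, f z ∂π) * Real.sqrt n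
          = (Real.sqrt (n : ℝ) * Real.sqrt n) * ((∑ t ∈ Finset.range n, f (ω r t)) / n - ∫ z, f z ∂π) := by ring
      rw [this, hsq]
      field_simp
    simp_rw [hV]
    exact (replica_sigmaHat_eq_svar (fun r => (∑ t ∈ Finset.range n, f (ω r t)) / n) (∫ z, f z ∂π)
      (R := R) hn0).symm
  · show (∑ j : Fin R, ((WithLp.toLp 2 (fun r : Fin R => Real.sqrt σ2 * g r) : EuclideanSpace ℝ (Fin R)) j
          - (∑ i : Fin R, (WithLp.toLp 2 (fun r : Fin R => Real.sqrt σ2 * g r) : EuclideanSpace ℝ (Fin R)) i) / (R : ℝ)) ^ 2)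
          / ((R : ℝ) - 1)
      = σ2 * ((∑ j, (g j - (∑ i, g i) / (R : ℝ)) ^ 2) / ((R : ℝ) - 1))
    dsimp only
    have : ∀ j : Fin R, Real.sqrt σ2 * g j - (∑ i, Real.sqrt σ2 * g i) / (R : ℝ)
        = Real.sqrt σ2 * (g j - (∑ i, g i) / (R : ℝ)) := fun j => by
      rw [← Finset.mul_sum]; ring
    simp_rw [this, mul_pow, Real.sq_sqrt hσ2nn, ← Finset.mul_sum]
    ring

/-- **THE STUDENT CALIBRATION OF THE BETWEEN-REPLICA INTERVAL AT A FIXED NUMBER OF STREAMS.**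
`σ²_f > 0`, `R ≥ 2` independent runs of length `n → ∞` from ANY starts, `z ≥ 0`: with `M_r` the
replica means and `SE²_rep = Σ_r (M_r − M̄)²/(R(R−1))`,
`(⊗_r P_{μ_r})(|M̄ − πf| ≤ z √SE²_rep) → N(0,1)^{⊗R}{R ḡ² ≤ z² s²(g)}` (Student-`t_{R−1}` of `[−z, z]`). -/
theorem chain_replicaMeans_fixedCount_coverage_of_envelope (hπ : Kernel.Invariant κ π)
    (henv : ∀ (g : Ω → ℝ), Measurable g → ∀ (Cg : ℝ), (∀ x, |g x| ≤ Cg) →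
      ∀ (t : ℕ) (x : Ω), |(kop κ)^[t] g x - ∫ y, g y ∂π| ≤ 2 * Cg * (A * ρ ^ t))
    (hA : 0 ≤ A) (hρ0 : 0 ≤ ρ) (hρ1 : ρ < 1)
    {f : Ω → ℝ} (hf : Measurable f) {C : ℝ} (hC : ∀ x, |f x| ≤ C)
    (hσ : 0 < ((∫ y, (f y - ∫ z, f z ∂(π)) ^ 2 ∂(π)) + 2 * ∑' k, ∫ y, (f y - ∫ z, f z ∂(π)) * (kop (κ))^[k + 1] (fun y => f y - ∫ z, f z ∂(π)) y ∂(π)))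
    {R : ℕ} (hR : 2 ≤ R) (μs : Fin R → Measure Ω) [∀ r, IsProbabilityMeasure (μs r)] {z : ℝ} (hz : 0 ≤ z)
    [∀ r, IsProbabilityMeasure (Kernel.trajMeasure (X := fun _ : ℕ => Ω) (μs r)
          (fun n : ℕ => κ.comap (fun h' : (i : ↥(Finset.Iic n)) → Ω => h' ⟨n, Finset.mem_Iic.2 le_rfl⟩)
            (measurable_pi_apply _)))] :
    Tendsto (fun n => (Measure.pi fun r => (Kernel.trajMeasure (X := fun _ : ℕ => Ω) (μs r)
          (fun n : ℕ => κ.comap (fun h' : (i : ↥(Finset.Iic n)) → Ω => h' ⟨n, Finset.mem_Iic.2 le_rfl⟩)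
            (measurable_pi_apply _)))).real
        {ω : Fin R → (ℕ → Ω) |
          |(∑ r, (∑ t ∈ Finset.range n, f (ω r t)) / n) / (R : ℝ) - ∫ z, f z ∂π|
            ≤ z * Real.sqrt ((∑ r, ((∑ t ∈ Finset.range n, f (ω r t)) / n
                - (∑ i, (∑ t ∈ Finset.range n, f (ω i t)) / n) / (R : ℝ)) ^ 2) / ((R : ℝ) * ((R : ℝ) - 1)))})
      atTop (𝓝 ((Measure.pi fun _ : Fin R => gaussianReal 0 1).real
        {g : Fin R → ℝ | (R : ℝ) * ((∑ i, g i) / (R : ℝ)) ^ 2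
            ≤ z ^ 2 * ((∑ j, (g j - (∑ i, g i) / (R : ℝ)) ^ 2) / ((R : ℝ) - 1))})) := by
  obtain ⟨k, rfl⟩ := Nat.exists_eq_succ_of_ne_zero (show R ≠ 0 by omega)
  have hk : 1 ≤ k := by omega
  set σ2 : ℝ := ((∫ y, (f y - ∫ z, f z ∂(π)) ^ 2 ∂(π)) + 2 * ∑' k, ∫ y, (f y - ∫ z, f z ∂(π)) * (kop (κ))^[k + 1] (fun y => f y - ∫ z, f z ∂(π)) y ∂(π)) with hσ2
  have hσ2nn : 0 ≤ σ2 := hσ.le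
  set Pg : Measure (Fin (k + 1) → ℝ) := Measure.pi fun _ : Fin (k + 1) => gaussianReal 0 1 with hPg
  have hJ := chain_replicaMeans_joint_clt_of_envelope hπ henv hA hρ0 hρ1 hf hC μs
  have hcont := hJ.continuous_comp (continuous_euclidean_student (k + 1) z)
  set h₀ : (Fin (k + 1) → ℝ) → ℝ := fun g => ((k + 1 : ℕ) : ℝ) * ((∑ i, g i) / ((k + 1 : ℕ) : ℝ)) ^ 2
      - z ^ 2 * ((∑ j, (g j - (∑ i, g i) / ((k + 1 : ℕ) : ℝ)) ^ 2) / (((k + 1 : ℕ) : ℝ) - 1)) with hh₀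
  have hh₀m : Measurable h₀ := by
    simp only [hh₀]
    fun_prop
  have hlim : ∀ g : Fin (k + 1) → ℝ, ((fun v : EuclideanSpace ℝ (Fin (k + 1)) =>
      ((k + 1 : ℕ) : ℝ) * ((∑ i, v i) / ((k + 1 : ℕ) : ℝ)) ^ 2
        - z ^ 2 * ((∑ j, (v j - (∑ i, v i) / ((k + 1 : ℕ) : ℝ)) ^ 2) / (((k + 1 : ℕ) : ℝ) - 1))) ∘
      (fun g : Fin (k + 1) → ℝ => (WithLp.toLp 2 (fun r : Fin (k + 1) => Real.sqrt σ2 * g r)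
        : EuclideanSpace ℝ (Fin (k + 1))))) g
      = σ2 * h₀ g := by
    intro g
    simp only [Function.comp, hh₀]
    have e1 : ∑ i, Real.sqrt σ2 * g i = Real.sqrt σ2 * ∑ i, g i := by rw [Finset.mul_sum]
    have e2 : ∀ j : Fin (k + 1), Real.sqrt σ2 * g j - Real.sqrt σ2 * (∑ i, g i) / ((k + 1 : ℕ) : ℝ)
        = Real.sqrt σ2 * (g j - (∑ i, g i) / ((k + 1 : ℕ) : ℝ)) := fun j => by ring
    show ((k + 1 : ℕ) : ℝ) * ((∑ i, Real.sqrt σ2 * g i) / ((k + 1 : ℕ) : ℝ)) ^ 2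
        - z ^ 2 * ((∑ j, (Real.sqrt σ2 * g j - (∑ i, Real.sqrt σ2 * g i) / ((k + 1 : ℕ) : ℝ)) ^ 2) / (((k + 1 : ℕ) : ℝ) - 1))
      = σ2 * (((k + 1 : ℕ) : ℝ) * ((∑ i, g i) / ((k + 1 : ℕ) : ℝ)) ^ 2
        - z ^ 2 * ((∑ j, (g j - (∑ i, g i) / ((k + 1 : ℕ) : ℝ)) ^ 2) / (((k + 1 : ℕ) : ℝ) - 1)))
    rw [e1]
    simp_rw [e2, mul_pow, Real.sq_sqrt hσ2nn, ← Finset.mul_sum]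
    have e3 : (Real.sqrt σ2 * ∑ i, g i) / ((k + 1 : ℕ) : ℝ) = Real.sqrt σ2 * ((∑ i, g i) / ((k + 1 : ℕ) : ℝ)) := by
      ring
    rw [e3, mul_pow, Real.sq_sqrt hσ2nn]
    ring
  have hclt := hcont.congr (fun n => ae_of_all _ fun x => rfl) (ae_of_all _ hlim)
  -- portmanteau on `(−∞, 0]`, null frontier
  have hZm : AEMeasurable (fun g : Fin (k + 1) → ℝ => σ2 * h₀ g) Pg := (hh₀m.const_mul σ2).aemeasurable
  have hfr : (Pg.map (fun g : Fin (k + 1) → ℝ => σ2 * h₀ g)) (frontier (Set.Iic (0 : ℝ))) = 0 := by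
    rw [frontier_Iic, Measure.map_apply_of_aemeasurable hZm (measurableSet_singleton 0)]
    have hset : (fun g : Fin (k + 1) → ℝ => σ2 * h₀ g) ⁻¹' {0} = {g | h₀ g = 0} := by
      ext g
      simp only [Set.mem_preimage, Set.mem_singleton_iff, Set.mem_setOf_eq, mul_eq_zero, hσ.ne', false_or]
    rw [hset]
    exact pi_gaussianReal_studentBoundary_eq_zero k hk z
  have key := CardConsistency.tendsto_measureReal_preimage_of_tendstoInDistribution hclt measurableSet_Iic hfr
  have hlimset : Pg.real ((fun g : Fin (k + 1) → ℝ => σ2 * h₀ g) ⁻¹' Set.Iic 0)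
      = Pg.real {g : Fin (k + 1) → ℝ | ((k + 1 : ℕ) : ℝ) * ((∑ i, g i) / ((k + 1 : ℕ) : ℝ)) ^ 2
            ≤ z ^ 2 * ((∑ j, (g j - (∑ i, g i) / ((k + 1 : ℕ) : ℝ)) ^ 2) / (((k + 1 : ℕ) : ℝ) - 1))} := by
    congr 1
    ext g
    simp only [Set.mem_preimage, Set.mem_Iic, Set.mem_setOf_eq, hh₀]
    constructor
    · intro h; nlinarith [hσ]
    · intro h; nlinarith [hσ]
  rw [hlimset] at key
  refine key.congr' ?_
  filter_upwards [Filter.eventually_gt_atTop 0] with n hn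
  congr 1
  ext ω
  simp only [Set.mem_preimage, Set.mem_Iic, Set.mem_setOf_eq, Function.comp]
  have hnR : (0 : ℝ) < n := Nat.cast_pos.2 hn
  have hsn : 0 < Real.sqrt n := Real.sqrt_pos.2 hnR
  have hV : ∀ r : Fin (k + 1), (∑ t ∈ Finset.range n, (f (ω r t) - ∫ z, f z ∂π)) / Real.sqrt n
      = Real.sqrt n * ((∑ t ∈ Finset.range n, f (ω r t)) / n - ∫ z, f z ∂π) := by
    intro r
    have hsq : Real.sqrt (n : ℝ) * Real.sqrt n = n := Real.mul_self_sqrt hnR.le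
    rw [div_eq_iff hsn.ne', Finset.sum_sub_distrib, Finset.sum_const, Finset.card_range, nsmul_eq_mul]
    have : Real.sqrt (n : ℝ) * ((∑ t ∈ Finset.range n, f (ω r t)) / n - ∫ z, f z ∂π) * Real.sqrt n
        = (Real.sqrt (n : ℝ) * Real.sqrt n) * ((∑ t ∈ Finset.range n, f (ω r t)) / n - ∫ z, f z ∂π) := by ring
    rw [this, hsq]
    field_simp
  simp only [hV]
  exact (replica_coverage_iff_student (fun r => (∑ t ∈ Finset.range n, f (ω r t)) / n) (∫ z, f z ∂π)
    hR hn hz).symm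

end Envelope

end Summit.Ventures.LatticeQCDFlow.Scoring

end
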